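import Summits.Ventures.PercRepro.S1TriangleV

/-!
# PercRepro — LEMMA V, the count: `3·Σ t(x)² ≤ |E|·Σ t(x)` and `9·s₃ ≤ |E|²` under (C1), (C2) (p2, gen 18)

The counting half of LEMMA V (the V lemma itself — two triangles through a point leave at least two of their four
cross pairs on no triangle — is `two_le_sum_uncovered_cross` in `S1TriangleV`). With `t(x)` the number of triangles
through `x`, `n = |E|`, `link a` the neighbours of `a` (`|link a| = 2·t(a)`) and `P(a)` the number of ordered pairs
of neighbours of `a` covered by no triangle: `2·t(a)² ≤ P(a) + 2·t(a)` (an ordered pair of distinct triangles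
through `a` gives two uncovered cross pairs, and a neighbour determines its triangle) and `Σ_a P(a) ≤ Σ_x 2·t(x)·(n −
1 − 2·t(x))` (an uncovered pair `(x, y)` seen from `a` has `a ∈ link x` and `y ∉ {x} ∪ link x`). Summing,
`3·Σ t(x)² ≤ n·Σ t(x)`; Cauchy–Schwarz and the double count `Σ t(x) = 3·s₃` give `9·s₃ ≤ n²`, i.e. `s₃ ≤ ⌊n²/9⌋`
— tight on `M(K₄)`; `136` at `n = 35`, the cell `(8, 27)` of the `q = 4` window.

* `two_mul_sq_le_sum_uncovered` — the lower count `2·t(a)² ≤ P(a) + 2·t(a)`;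
* `sum_uncovered_add_le` — the upper count `Σ_a P(a) + Σ_x 2·t(x)·(1 + 2·t(x)) ≤ Σ_x 2·t(x)·n`;
* **`three_mul_sum_sq_ncard_trianglesThrough_le`** — `3·Σ t(x)² ≤ n·Σ t(x)`;
* `sum_ncard_trianglesThrough_eq` — `Σ_x t(x) = 3·s₃`;
* **`nine_mul_ncard_triangles_le_sq`** — `9·s₃ ≤ n²` under (C1), (C2); `ncard_triangles_le_sq_div_nine`;
* **`core_nine_mul_ncard_triangles_le_sq`**, **`core_ncard_triangles_le_sq_div_nine`** — on the `e`-free core.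
Axioms: standard.
-/

open scoped Matroid

namespace PercRepro

namespace S1

open Set

variable {α : Type}

open Classical in
/-- **The lower count**: `2·t(a)² ≤ P(a) + 2·t(a)`, where `P(a)` is the number of ordered pairs of neighbours of
`a` covered by no triangle (under (C1), (C2)). -/
theorem two_mul_sq_le_sum_uncovered (M : Matroid α) [M.Finite]
    (hC1 : ∀ L ⊆ M.E, M.eRk L = 2 → L.ncard ≤ 3) (hC2 : ∀ P ⊆ M.E, M.eRk P ≤ 3 → P.ncard ≤ 6) (a : α) :
    2 * (ThmN.trianglesThrough M a).ncard ^ 2 ≤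
      (∑ x ∈ link M a, ∑ y ∈ link M a, if covered M x y then 0 else 1) +
        2 * (ThmN.trianglesThrough M a).ncard := by
  classical
  have hdisj := pairwiseDisjoint_ptsOff M hC1 a
  rw [link_eq_biUnion, Finset.sum_biUnion hdisj]
  simp_rw [Finset.sum_biUnion hdisj]
  have hswap : ∀ T, (∑ x ∈ ptsOff M a T, ∑ T' ∈ tris M a, ∑ y ∈ ptsOff M a T',
      if covered M x y then 0 else 1) =
      ∑ T' ∈ tris M a, ∑ x ∈ ptsOff M a T, ∑ y ∈ ptsOff M a T', if covered M x y then 0 else 1 :=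
    fun T => Finset.sum_comm
  simp_rw [hswap]
  have hkey : ∀ T ∈ tris M a, 2 * (ThmN.trianglesThrough M a).ncard ≤
      (∑ T' ∈ tris M a, ∑ x ∈ ptsOff M a T, ∑ y ∈ ptsOff M a T', if covered M x y then 0 else 1) + 2 := by
    intro T hT
    have hge : (∑ T' ∈ tris M a, if T' = T then 0 else 2) ≤
        ∑ T' ∈ tris M a, ∑ x ∈ ptsOff M a T, ∑ y ∈ ptsOff M a T', if covered M x y then 0 else 1 := by
      apply Finset.sum_le_sum
      intro T' hT'
      split_ifs with hTT
      · exact Nat.zero_le _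
      · obtain ⟨b, c, hbc, hbc_eq⟩ := Finset.card_eq_two.1 (card_ptsOff M ((mem_tris M).1 hT))
        obtain ⟨d, e, hde, hde_eq⟩ := Finset.card_eq_two.1 (card_ptsOff M ((mem_tris M).1 hT'))
        have hb : b ∈ ptsOff M a T := by rw [hbc_eq]; exact Finset.mem_insert_self _ _
        have hc : c ∈ ptsOff M a T := by
          rw [hbc_eq]; exact Finset.mem_insert_of_mem (Finset.mem_singleton_self _)
        have hd : d ∈ ptsOff M a T' := by rw [hde_eq]; exact Finset.mem_insert_self _ _
        have he : e ∈ ptsOff M a T' := by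
          rw [hde_eq]; exact Finset.mem_insert_of_mem (Finset.mem_singleton_self _)
        rw [mem_ptsOff] at hb hc hd he
        rw [hbc_eq, hde_eq]
        exact two_le_sum_uncovered_cross M hC1 hC2 ((mem_tris M).1 hT) ((mem_tris M).1 hT') (Ne.symm hTT)
          hb.2.1 hb.2.2 hc.2.1 hc.2.2 hbc hd.2.1 hd.2.2 he.2.1 he.2.2 hde
    have hsum : (∑ T' ∈ tris M a, if T' = T then 0 else 2) + 2 = 2 * (ThmN.trianglesThrough M a).ncard := by
      have h1 : (∑ T' ∈ tris M a, if T' = T then 0 else 2) + ∑ T' ∈ tris M a, (if T' = T then 2 else 0) =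
          ∑ _T' ∈ tris M a, 2 := by
        rw [← Finset.sum_add_distrib]
        apply Finset.sum_congr rfl
        intro T' _
        split_ifs <;> rfl
      rw [Finset.sum_ite_eq', if_pos hT, Finset.sum_const, smul_eq_mul, card_tris, mul_comm] at h1
      exact h1
    omega
  have htot := Finset.sum_le_sum hkey
  rw [Finset.sum_const, smul_eq_mul, card_tris, Finset.sum_add_distrib, Finset.sum_const, smul_eq_mul,
    card_tris] at htot
  nlinarith [htot]

open Classical in
/-- **The upper count**: `Σ_a P(a) + Σ_x 2·t(x)·(1 + 2·t(x)) ≤ Σ_x 2·t(x)·n` — an uncovered ordered pair `(x, y)`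
of neighbours of `a` has `a` among the `2·t(x)` neighbours of `x` and `y` outside `{x} ∪ link x`. -/
theorem sum_uncovered_add_le (M : Matroid α) [M.Finite] (hC1 : ∀ L ⊆ M.E, M.eRk L = 2 → L.ncard ≤ 3) :
    (∑ a ∈ M.ground_finite.toFinset, ∑ x ∈ link M a, ∑ y ∈ link M a, if covered M x y then 0 else 1) +
      ∑ x ∈ M.ground_finite.toFinset,
        2 * (ThmN.trianglesThrough M x).ncard * (1 + 2 * (ThmN.trianglesThrough M x).ncard) ≤
      ∑ x ∈ M.ground_finite.toFinset, 2 * (ThmN.trianglesThrough M x).ncard * M.E.ncard := by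
  classical
  have hmemE : ∀ x, x ∈ M.ground_finite.toFinset ↔ x ∈ M.E := fun x =>
    Set.Finite.mem_toFinset M.ground_finite
  have hEcard : M.ground_finite.toFinset.card = M.E.ncard :=
    (Set.ncard_eq_toFinset_card _ M.ground_finite).symm
  have hlinkE : ∀ a, link M a ⊆ M.ground_finite.toFinset := fun a x hx =>
    (hmemE x).2 ((mem_link M).1 hx).1
  have hind : ∀ a, (∑ x ∈ link M a, ∑ y ∈ link M a, if covered M x y then 0 else 1) =
      ∑ x ∈ M.ground_finite.toFinset,
        if x ∈ link M a then (∑ y ∈ link M a, if covered M x y then 0 else 1) else 0 := by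
    intro a
    rw [Finset.sum_ite_mem, Finset.inter_eq_right.2 (hlinkE a)]
  simp_rw [hind]
  rw [Finset.sum_comm, ← Finset.sum_add_distrib]
  apply Finset.sum_le_sum
  intro x hx
  have hxlink : x ∉ link M x := fun h => ((mem_link M).1 h).2.1 rfl
  have hins : insert x (link M x) ⊆ M.ground_finite.toFinset := Finset.insert_subset hx (hlinkE x)
  have hKcard : (M.ground_finite.toFinset \ insert x (link M x)).card +
      (2 * (ThmN.trianglesThrough M x).ncard + 1) = M.E.ncard := by
    have h := Finset.card_sdiff_add_card_eq_card hins
    rw [Finset.card_insert_of_notMem hxlink, card_link M hC1 x, hEcard] at h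
    exact h
  have hterm : ∀ a ∈ M.ground_finite.toFinset,
      (if x ∈ link M a then (∑ y ∈ link M a, if covered M x y then 0 else 1) else 0) ≤
        if a ∈ link M x then (M.ground_finite.toFinset \ insert x (link M x)).card else 0 := by
    intro a ha
    split_ifs with h1 h2
    · calc (∑ y ∈ link M a, if covered M x y then 0 else 1)
          = ((link M a).filter (fun y => ¬ covered M x y)).card := by
            rw [Finset.card_filter]
            apply Finset.sum_congr rfl
            intro y _
            rw [ite_not]
        _ ≤ (M.ground_finite.toFinset \ insert x (link M x)).card := by
            apply Finset.card_le_card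
            intro y hy
            rw [Finset.mem_filter] at hy
            rw [Finset.mem_sdiff, Finset.mem_insert]
            refine ⟨hlinkE a hy.1, ?_⟩
            rintro (hyx | hyx)
            · apply hy.2
              obtain ⟨-, -, C, hC, hxC⟩ := (mem_link M).1 h1
              rw [hyx]
              exact ⟨C, ⟨hC.1, hC.2.1⟩, hxC, hxC⟩
            · apply hy.2
              obtain ⟨-, -, C, hC, hyC⟩ := (mem_link M).1 hyx
              exact ⟨C, ⟨hC.1, hC.2.1⟩, hC.2.2, hyC⟩
    · exact absurd (mem_link_symm M ((hmemE a).1 ha) h1) h2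
    · exact Nat.zero_le _
    · exact le_rfl
  have hsum1 := Finset.sum_le_sum hterm
  rw [Finset.sum_ite_mem, Finset.inter_eq_right.2 (hlinkE x), Finset.sum_const, smul_eq_mul,
    card_link M hC1 x] at hsum1
  rw [← hKcard]
  nlinarith [hsum1]

/-- **LEMMA V, the sum form**: under (C1) and (C2), `3·Σ_x t(x)² ≤ |E|·Σ_x t(x)`, where `t(x)` is the number of
triangles through `x`. -/
theorem three_mul_sum_sq_ncard_trianglesThrough_le (M : Matroid α) [M.Finite]
    (hC1 : ∀ L ⊆ M.E, M.eRk L = 2 → L.ncard ≤ 3) (hC2 : ∀ P ⊆ M.E, M.eRk P ≤ 3 → P.ncard ≤ 6) :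
    3 * ∑ x ∈ M.ground_finite.toFinset, (ThmN.trianglesThrough M x).ncard ^ 2 ≤
      M.E.ncard * ∑ x ∈ M.ground_finite.toFinset, (ThmN.trianglesThrough M x).ncard := by
  classical
  have hlow : ∑ a ∈ M.ground_finite.toFinset, 2 * (ThmN.trianglesThrough M a).ncard ^ 2 ≤
      ∑ a ∈ M.ground_finite.toFinset,
        ((∑ x ∈ link M a, ∑ y ∈ link M a, if covered M x y then 0 else 1) +
          2 * (ThmN.trianglesThrough M a).ncard) :=
    Finset.sum_le_sum (fun a _ => two_mul_sq_le_sum_uncovered M hC1 hC2 a)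
  rw [Finset.sum_add_distrib, ← Finset.mul_sum, ← Finset.mul_sum] at hlow
  have hup := sum_uncovered_add_le M hC1
  have e3 : ∑ x ∈ M.ground_finite.toFinset,
      2 * (ThmN.trianglesThrough M x).ncard * (1 + 2 * (ThmN.trianglesThrough M x).ncard) =
      2 * ∑ x ∈ M.ground_finite.toFinset, (ThmN.trianglesThrough M x).ncard +
        4 * ∑ x ∈ M.ground_finite.toFinset, (ThmN.trianglesThrough M x).ncard ^ 2 := by
    rw [Finset.mul_sum, Finset.mul_sum, ← Finset.sum_add_distrib]
    apply Finset.sum_congr rfl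
    intro x _
    ring
  have e4 : ∑ x ∈ M.ground_finite.toFinset, 2 * (ThmN.trianglesThrough M x).ncard * M.E.ncard =
      2 * M.E.ncard * ∑ x ∈ M.ground_finite.toFinset, (ThmN.trianglesThrough M x).ncard := by
    rw [Finset.mul_sum]
    apply Finset.sum_congr rfl
    intro x _
    ring
  rw [e3, e4] at hup
  linarith

/-- **Double count**: `Σ_{x ∈ E} t(x) = 3·s₃`. -/
theorem sum_ncard_trianglesThrough_eq (M : Matroid α) [M.Finite] :
    ∑ x ∈ M.ground_finite.toFinset, (ThmN.trianglesThrough M x).ncard = 3 * (ThmN.triangles M).ncard := by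
  classical
  have hTfin : (ThmN.triangles M).Finite :=
    M.ground_finite.finite_subsets.subset (fun C hC => hC.1.subset_ground)
  set Tf : Finset (Set α) := hTfin.toFinset with hTf
  set Ef : Finset α := M.ground_finite.toFinset with hEf
  have hmemT : ∀ C, C ∈ Tf ↔ C ∈ ThmN.triangles M := fun C => Set.Finite.mem_toFinset hTfin
  have hmemE : ∀ x, x ∈ Ef ↔ x ∈ M.E := fun x => Set.Finite.mem_toFinset M.ground_finite
  have hrow : ∀ C ∈ Tf, ∑ x ∈ Ef, (if x ∈ C then 1 else 0) = 3 := by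
    intro C hC
    rw [Finset.sum_boole, Nat.cast_id]
    have hCT : C ∈ ThmN.triangles M := (hmemT C).1 hC
    have hCfin : C.Finite := M.ground_finite.subset hCT.1.subset_ground
    have hfilter : (Ef.filter (fun x => x ∈ C)) = hCfin.toFinset := by
      ext x
      simp only [Finset.mem_filter, Set.Finite.mem_toFinset]
      constructor
      · rintro ⟨-, hx⟩; exact hx
      · intro hx
        exact ⟨(hmemE x).2 (hCT.1.subset_ground hx), hx⟩
    rw [hfilter, ← Set.ncard_eq_toFinset_card C hCfin, hCT.2]
  have hcol : ∀ x ∈ Ef, ∑ C ∈ Tf, (if x ∈ C then 1 else 0) = (ThmN.trianglesThrough M x).ncard := by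
    intro x _
    rw [Finset.sum_boole, Nat.cast_id]
    have hfilter : ((Tf.filter (fun C => x ∈ C)) : Set (Set α)) = ThmN.trianglesThrough M x := by
      ext C
      simp only [Finset.coe_filter, Set.mem_setOf_eq, hmemT, ThmN.triangles, ThmN.trianglesThrough]
      tauto
    rw [← hfilter, Set.ncard_coe_finset]
  calc ∑ x ∈ Ef, (ThmN.trianglesThrough M x).ncard
      = ∑ x ∈ Ef, ∑ C ∈ Tf, (if x ∈ C then 1 else 0) := Finset.sum_congr rfl (fun x hx => (hcol x hx).symm)
    _ = ∑ C ∈ Tf, ∑ x ∈ Ef, (if x ∈ C then 1 else 0) := Finset.sum_comm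
    _ = ∑ _C ∈ Tf, 3 := Finset.sum_congr rfl hrow
    _ = 3 * (ThmN.triangles M).ncard := by
        rw [Finset.sum_const, smul_eq_mul, hTf, ← Set.ncard_eq_toFinset_card _ hTfin, mul_comm]

/-- **LEMMA V**: under (C1) and (C2), `9·s₃ ≤ |E|²` (Cauchy–Schwarz on `3·Σ t(x)² ≤ |E|·Σ t(x)`, with
`Σ t(x) = 3·s₃`). -/
theorem nine_mul_ncard_triangles_le_sq (M : Matroid α) [M.Finite]
    (hC1 : ∀ L ⊆ M.E, M.eRk L = 2 → L.ncard ≤ 3) (hC2 : ∀ P ⊆ M.E, M.eRk P ≤ 3 → P.ncard ≤ 6) :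
    9 * (ThmN.triangles M).ncard ≤ M.E.ncard ^ 2 := by
  classical
  have hA := three_mul_sum_sq_ncard_trianglesThrough_le M hC1 hC2
  have hCS := sq_sum_le_card_mul_sum_sq (s := M.ground_finite.toFinset)
    (f := fun x => (ThmN.trianglesThrough M x).ncard)
  have hsum := sum_ncard_trianglesThrough_eq M
  have hEcard : M.ground_finite.toFinset.card = M.E.ncard :=
    (Set.ncard_eq_toFinset_card _ M.ground_finite).symm
  rw [hEcard] at hCS
  set S1 := ∑ x ∈ M.ground_finite.toFinset, (ThmN.trianglesThrough M x).ncard with hS1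
  set S2 := ∑ x ∈ M.ground_finite.toFinset, (ThmN.trianglesThrough M x).ncard ^ 2 with hS2
  set n := M.E.ncard with hn
  have h1 : 3 * S1 ^ 2 ≤ n ^ 2 * S1 := by nlinarith
  rcases Nat.eq_zero_or_pos S1 with h0 | hpos
  · rw [h0] at hsum
    omega
  · have h2 : 3 * S1 * S1 ≤ n ^ 2 * S1 := by nlinarith [h1]
    have h3 : 3 * S1 ≤ n ^ 2 := Nat.le_of_mul_le_mul_right h2 hpos
    omega

/-- **LEMMA V, the cap**: `s₃ ≤ ⌊|E|²/9⌋` under (C1), (C2). -/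
theorem ncard_triangles_le_sq_div_nine (M : Matroid α) [M.Finite]
    (hC1 : ∀ L ⊆ M.E, M.eRk L = 2 → L.ncard ≤ 3) (hC2 : ∀ P ⊆ M.E, M.eRk P ≤ 3 → P.ncard ≤ 6) :
    (ThmN.triangles M).ncard ≤ M.E.ncard ^ 2 / 9 := by
  rw [Nat.le_div_iff_mul_le (by norm_num), mul_comm]
  exact nine_mul_ncard_triangles_le_sq M hC1 hC2

/-- **LEMMA V on the `e`-free core**, in the set-builder vocabulary of `S1RowTwelve`: `9·s₃ ≤ |E|²`. -/
theorem core_nine_mul_ncard_triangles_le_sq (M : Matroid α) [M.Finite]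
    (hfree : ∀ e ∈ M.E, ∃ A ⊆ M.E \ {e}, e ∉ M.closure A ∧ e ∉ M.closure ((M.E \ {e}) \ A)) :
    9 * {C : Set α | M.IsCircuit C ∧ C.ncard = 3}.ncard ≤ M.E.ncard ^ 2 := by
  have hL : ∀ e ∈ M.E, ¬ M.IsLoop e := ThmN.not_isLoop_of_free M hfree
  have hline : ∀ L ⊆ M.E, M.eRk L = 2 → L.ncard ≤ 3 := by
    intro L hL' hr
    have := ThmN.ncard_add_one_le_two_pow_of_eRk_le M hL hfree 2 L hL' hr.le
    omega
  have hplane : ∀ P ⊆ M.E, M.eRk P ≤ 3 → P.ncard ≤ 6 := fun P hP hr =>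
    ThmN.ncard_le_six_of_eRk_le_three_of_free M hfree hP hr
  exact nine_mul_ncard_triangles_le_sq M hline hplane

/-- **LEMMA V on the `e`-free core, the cap**: `s₃ ≤ ⌊|E|²/9⌋`. -/
theorem core_ncard_triangles_le_sq_div_nine (M : Matroid α) [M.Finite]
    (hfree : ∀ e ∈ M.E, ∃ A ⊆ M.E \ {e}, e ∉ M.closure A ∧ e ∉ M.closure ((M.E \ {e}) \ A)) :
    {C : Set α | M.IsCircuit C ∧ C.ncard = 3}.ncard ≤ M.E.ncard ^ 2 / 9 := by
  rw [Nat.le_div_iff_mul_le (by norm_num), mul_comm]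
  exact core_nine_mul_ncard_triangles_le_sq M hfree

end S1

end PercRepro
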